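import Literature.NumberTheory.Automorphic.HeckeTraceFormulaGL2Level
import Mathlib.FieldTheory.Finite.GaloisField
import Mathlib.NumberTheory.LegendreSymbol.JacobiSymbol

/-!
# Venture AbcSig — the NON-SPLIT-CARTAN LOCAL FACTOR of the character trace formula behind the cell's instrument
# «LocalTypeNSC» (module M9-NSC), TYPED (STATEMENT ONLY: definitions + named hypothesis-`Prop`s; no census numbers)

HONEST FRAMING. This file TYPES, in the tree's vocabulary, the GEOMETRIC SIDE of the weight-2 character trace formula
for the non-split Cartan level structure at an odd prime `p` (times `Γ₀(M)`, `p ∤ M`) that the computation cell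
`pub-abcsig` DERIVED and uses to read the local type at `p` (`p² ∥ N`, `a_p = 0`) of a newform orbit
(HOME `engine/engine-2/results/NSCARTAN-g17/RECORD-NSCARTAN-engine2-g17.md` §1 (S)(G)(E); referee re-derivation
`referee/ref-g57/nsc/NSC-READ-g57.md` §3; lead's RULING PINS-NSC/LL2 (γ3), 2026-08-25T00:02:13Z: «the non-split-Cartan
local factor is the cell's OWN DERIVATION»; lead g12 WORD LEAN-TUESDAY (c), 2026-08-25T02:57:51Z: «a statement-only file
importing `Literature.NumberTheory.Automorphic.HeckeTraceFormulaGL2Level` that states ONLY the non-split-Cartan local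
factor the cell derived»). NOTHING here is proved about modular forms, nothing is a claim on ABC, on any Diophantine
equation or on any summit; the `Prop`s of §4 are HYPOTHESIS-DEFINITIONS (never axioms) whose INTENDED
instantiation is spelled out in their docstrings, exactly like the cell's `NewformModel.DataComplete` /
`NewformModel.BS04Package` (`Recipes/BS04.lean`): MEANINGFUL ONLY FOR THE INTENDED MODEL.

WHAT IS IMPORTED, NOT RE-STATED (lit g13, LOCALTYPE-PIN.md LT16-A, 2026-08-25T01:10:50Z). The `Γ₀(M)` ingredients of
the Eichler–Selberg / Cohen–Oesterlé formula — the Dedekind `ψ`, the weighted class numbers `h_w` (`h_w(-3) = 1/3`,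
`h_w(-4) = 1/2`, `h_w(Δ) = h(Δ)` else), the set of conductors `f` (`f² ∣ t² - 4ℓ`, `(t² - 4ℓ)/f² ≡ 0, 1 (mod 4)`) and
Cohen's local density `μ_M(t, f, ℓ)` — are the tree's `dedekindPsi`, `weightedClassNumber`, `ellipticConductors`,
`localDensity` of `Literature/NumberTheory/Automorphic/HeckeTraceFormulaGL2Level.lean` ([SchoofVandervlugt1991,
Thm. 2.2] = [Belabas–Cohen 2018, Thm. 3] up to the sign/`½` bookkeeping recorded there). ONLY the factor AT `p` is new.

THE LOCAL FACTOR AT `p` (RECORD-NSCARTAN §1 (G); NSC-READ-g57 §3 (G)). Notation: `G = GL₂(𝔽_p) ⊃ T = 𝔽_{p²}^× ⊃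
Z = 𝔽_p^×` (a non-split Cartan subgroup and the centre; `T/Z` is cyclic of order `p + 1`); `O_T = {B ∈ M₂(ℤ_p) :
B mod p ∈ 𝔽_{p²}}` (= I. Chen's order `R_{non-split,λ}(p) = {(a b; c d) : a ≡ d, c ≡ λb (mod p)}`, `(λ/p) = -1`);
`ν` a character of `T/Z`; for an integer `t` and a prime `ℓ` with `((t² - 4ℓ)/p) = -1` ("`t` INERT at `p`") let
`τ_t ∈ T/Z` be the class of a root of `X² - tX + ℓ` in `𝔽_{p²}` (the two roots `τ, τ^p` give `ν(τ^p) = ν(τ)^p = ν(τ)⁻¹`,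
as `ν(τ)^{p+1} = ν(N τ) = 1`). The `ν`-weighted number of `O_T^×`-classes of optimal embeddings of the order of conductor
`f`, `p ∤ f`, of `ℚ(√(t² - 4ℓ))` into `O_T` is
  (I)  `c_p(t, ℓ, f; ν) = ν(τ_t) + ν(τ_t)⁻¹` if `t` is inert at `p` (two classes, `z₀N_G(T)/T`, swapped by `τ ↦ τ^p`);
  (II) `ν`-INDEPENDENT (classes through scalars only) if `t² - 4ℓ` is a square or zero mod `p` or `p ∣ f`.
The UNWEIGHTED counts (`ν = 1`: `2` resp. `0` for `p ∤ f`; `p - 2, p - 1, p` in the non-maximal cases) are PRINTED in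
[I. Chen, *The Jacobian of modular curves associated to Cartan subgroups*, DPhil thesis, Oxford 1996, Prop. 3.4.1,
p. 49 (held: `paper:doi-10-5287-ora-br00ev6oq`)], whose §3.4 computes exactly these embedding numbers for `R_{non-split,λ}(p)`
and whose §3.7 is the explicit trace formula for `Γ_{non-split}(p)` with TRIVIAL character; the `ν`-WEIGHTING (I) is the
cell's derivation (Bruhat–Tits tree / Bass: the two classes are the two cosets of `z₀N_G(T)/T`, both fixed by the image
of the embedded order, with weights `ν(τ)` and `ν(τ^p)`), evidenced by the referee's import-disjoint identities
(784/784 at `M = 2`, 296/296 at `M = 1`, `p = 47`) and 13/13 Kodaira ground truths — DERIVED, not printed, not proved here.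

CONSEQUENCE TYPED BELOW («mode A» of the RECORD: `ℓ` prime, `ℓ ∤ pM`, `4ℓ < p²`, `ℓ ≢ 1 (mod p)`, where no
`ν`-independent term survives: `0 < 4ℓ - t² < p²` kills case (II), `ℓ ≢ 1` kills the hyperbolic classes, `A₁ = 0` for
`ℓ` prime, `A₄` only meets `ν ∈ {1, θ₂}`). For a character `ν` of `T/Z` with `ν² ≠ 1` (order `≥ 3`):
  `Tr(T_ℓ^ν | V[ν]) = -E_ν(ℓ)`,  `E_ν(ℓ) = ½ Σ_{t² < 4ℓ, t inert at p} (ν(τ_t) + ν(τ_t)⁻¹) · W_t(ℓ)`,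
  `W_t(ℓ) = Σ_{f ∈ ellipticConductors t ℓ, p ∤ f} h_w((t² - 4ℓ)/f²) · μ_M(t, f, ℓ)`
(tree convention for `h_w`; the RECORD writes `h/w = ½ h_w` and absorbs the `½`), where `V[ν]` = weight-2 cusp forms of
level `K₀(M)·K_T(p)` and `T`-character `ν` (= forms on `Γ_T = {γ ∈ Γ₀(M) : γ mod p ∈ T}` with `f|γ = ν(γ̄) f`, Hecke
operators `T_ℓ^ν` with representatives reducing into `T`, weighted `ν(ᾱ)⁻¹`; RECORD §1). Summed over the `φ(d)`
characters of exact order `d` (`d ∣ p + 1`, `d ≥ 3`; Ramanujan sums `c_d`): with `X(ℓ) := Σ_π m_M(π) a_ℓ(π)` over all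
cuspidal `π` of conductor `p^a M'` (`a ≤ 2`, `M' ∣ M`), trivial central character, `m_M(π) = d(M/M')`, and
`S_d(ℓ) :=` the same sum over the `π` whose `π_p` is the depth-zero supercuspidal `Ind θ`, `ord θ = d`:
  `S_d(ℓ) = (φ(d)/2)·X(ℓ) + ½ Σ_{t² < 4ℓ, t inert at p} c_d(k_t) · W_t(ℓ)`,   `c_d(k_t) = Σ_{ord ν = d} ν(τ_t)`
— the equations the certificates `LocalTypeNSC_*.engine2.json` solve and verify (RECORD §1 (E)). The spectral table
(S) behind `X - S_ν` ([Fulton–Harris §5.2], [Bump 4.1.4–4.1.6/4.8.1], [LW12 3.3/3.4/3.10]) and the reading «type `θ_d`,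
`d ≠ 4` ⇒ `(f, n)` excluded» (RULING M9 (2), [BS04 L2.1]) are CITED elsewhere (LOCALTYPE-PIN LT16) and NOT typed here.

LEAN RENDERING (this file; all elementary, exact):
* `IsInert p t ℓ` (`jacobiSym (t² - 4ℓ) p = -1`); `lucasU`, `torusOrder p t ℓ` = the order of `τ_t` in `T/Z`, computed
  WITHOUT constructing `𝔽_{p²}`: in `𝔽_p[X]/(X² - tX + ℓ)` one has `X^m ≡ U_m X - ℓ U_{m-1}` (`U` the Lucas sequence of
  `(t, ℓ)`), so `τ_t^m ∈ 𝔽_p ⟺ p ∣ U_m(t, ℓ)` (DERIVED, elementary); `ramanujanSum d k = c_d(k) = Σ_{e ∣ (d, k)} μ(d/e) e`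
  (computed by the divisor recursion `Σ_{e ∣ d} c_e(k) = d·[d ∣ k]`, kernel-evaluable) and `orderWeight p d t ℓ = c_d(k_t)`,
  using that `c_d(k)` depends on `gcd(d, k) = gcd(d, (p+1)/ord τ_t)` only (generator-free);
* `localDensityTriv M t f ℓ : ℚ` = `μ_M(t, f, ℓ)` for the TRIVIAL character mod `M` (extended by `0` off the units, as
  printed), a `ℚ`-valued twin of the imported `localDensity M 1 t f ℓ`; `classSum M p t ℓ = W_t(ℓ)`;
  `orderEllipticSum M p d ℓ = ½ Σ_t c_d(k_t) W_t(ℓ)`; `beta` (Dirichlet inverse of `σ₀`) and `newEllipticSum` (the «`M`-new» projection);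
* per character, generator-free over Mathlib's `GaloisField p 2`: `IsTorusChar p ν` (`ν : (GaloisField p 2)ˣ →* ℂˣ`
  trivial on `𝔽_p^×`), `charLocalFactor p ν t ℓ = ν(τ_t) + ν(τ_t)⁻¹` (case (I); junk `0` if `X² - tX + ℓ` has no unit
  root, which does not happen), `charEllipticSum M p ν ℓ = E_ν(ℓ)`;
* `ModeA p M ℓ`; the hypothesis-defs `TraceIdentityModeA p M tr` (per character; `tr ν ℓ` INTENDED `= Tr(T_ℓ^ν | V[ν])`)
  and `TypeSumIdentityModeA p M X S` / `NewTypeSumIdentityModeA` (per exact order `d`; `X`, `S d` INTENDED as above). The cell's DERIVED CLAIM is that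
  the intended `tr`, `X`, `S` satisfy them for every odd prime `p` and every `M ≥ 1` with `p ∤ M`; a kernel checker of a
  certificate `LocalTypeNSC_N_….json` would instantiate `X`, `S` from the tree's level data and a 0/1 type table.
Kernel sanity `example`s use tiny generic numbers only (no census level).

p-lean g9 (prover-pub-abcsig-p-lean-g9-0), 2026-08-25.
-/

open Literature.NumberTheory.Automorphic.HeckeTraceFormulaGL2Level

namespace Summit.Ventures.AbcSig.NSCartan

/-! ## 1. The torus `T/Z` elementarily: inert traces, the order of `τ_t`, Ramanujan sums -/

/-- `t` is INERT at `p` for the prime `ℓ`: the discriminant `t² - 4ℓ` of `X² - tX + ℓ` is a quadratic non-residue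
mod `p`, i.e. the order `ℤ[(t + √(t² - 4ℓ))/2] ⊗ ℤ_p` is the unramified quadratic ring and a root `τ_t` generates
`𝔽_{p²}` over `𝔽_p` (case (I) of the local factor). -/
def IsInert (p : ℕ) (t : ℤ) (ℓ : ℕ) : Prop := jacobiSym (t ^ 2 - 4 * ℓ) p = -1

/-- `IsInert` is a decidable integer equality. -/
instance (p : ℕ) (t : ℤ) (ℓ : ℕ) : Decidable (IsInert p t ℓ) := inferInstanceAs (Decidable (_ = _))

/-- The Lucas sequence `U_m(t, n)`: `U₀ = 0`, `U₁ = 1`, `U_{m+2} = t U_{m+1} - n U_m`; in `ℤ[X]/(X² - tX + n)` one has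
`X^m = U_m X - n U_{m-1}` for `m ≥ 1`. [folklore] -/
def lucasU (t n : ℤ) : ℕ → ℤ
  | 0 => 0
  | 1 => 1
  | m + 2 => t * lucasU t n (m + 1) - n * lucasU t n m

/-- `torusOrder p t ℓ`: the least `m` with `1 ≤ m ≤ p + 1` and `p ∣ U_m(t, ℓ)` (junk `0` if there is none). For `t`
inert at `p` this is the ORDER of the class `τ_t` of a root of `X² - tX + ℓ` in `T/Z = 𝔽_{p²}^×/𝔽_p^×` (cyclic of order
`p + 1`): `τ_t^m ∈ 𝔽_p ⟺ p ∣ U_m(t, ℓ)` since `X^m ≡ U_m X - ℓ U_{m-1} (mod X² - tX + ℓ)` — DERIVED (elementary), so that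
no model of `𝔽_{p²}` and no generator of `T/Z` is needed. -/
def torusOrder (p : ℕ) (t : ℤ) (ℓ : ℕ) : ℕ :=
  (((List.range (p + 2)).filter fun m => decide (0 < m ∧ (p : ℤ) ∣ lucasU t ℓ m)).head?).getD 0

/-- Ramanujan sums by the divisor recursion: the sum of `ζ^k` over ALL `d`-th roots of unity `ζ` is `d·[d ∣ k]` and
splits over the exact orders `e ∣ d` of `ζ`, so `c_d(k) = d·[d ∣ k] - Σ_{e ∣ d, e < d} c_e(k)` (structural recursion on
a fuel argument `≥ d`, so that the kernel evaluates it; `Nat.properDivisors`). [folklore] -/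
def ramanujanSumAux (k : ℕ) : ℕ → ℕ → ℤ
  | 0, _ => 0
  | fuel + 1, d => (if d ∣ k then (d : ℤ) else 0) - ∑ e ∈ d.properDivisors, ramanujanSumAux k fuel e

/-- The Ramanujan sum `c_d(k) = Σ_{ζ primitive d-th root of 1} ζ^k = Σ_{e ∣ gcd(d, k)} μ(d/e)·e` (so `c_d(0) = φ(d)`,
`c_d(1) = μ(d)`), computed by the divisor recursion `ramanujanSumAux` with fuel `d`. [folklore] -/
def ramanujanSum (d k : ℕ) : ℤ := ramanujanSumAux k d d

/-- `orderWeight p d t ℓ = c_d(k_t) = Σ_{ν : ord ν = d} ν(τ_t)`, the sum of `ν(τ_t)` over the `φ(d)` characters `ν` of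
`T/Z` of exact order `d` (`d ∣ p + 1`), written generator-free: if `τ_t = g^{k_t}` for a generator `g` then
`gcd(d, k_t) = gcd(d, (p + 1)/ord τ_t)`, and `c_d(k)` depends on `gcd(d, k)` only — DERIVED (characters of a cyclic
group). This is the weight with which the inert trace `t` enters the type-`θ_d` equation of RECORD-NSCARTAN §1 (E). -/
def orderWeight (p d : ℕ) (t : ℤ) (ℓ : ℕ) : ℤ := ramanujanSum d ((p + 1) / torusOrder p t ℓ)

/-! ## 2. The `Γ₀(M)` ingredients (imported) and the class sums `W_t(ℓ)` -/

/-- Cohen's local density `μ_M(t, f, ℓ) = ψ(M)/ψ(M/M_f) · #{x (mod M) : gcd(x, M) = 1, M·M_f ∣ x² - tx + ℓ}`,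
`M_f = gcd(M, f)`, for the TRIVIAL character mod `M` (value `0` off the units, as printed), `ℚ`-valued: the rational twin
of the imported `localDensity M (1 : DirichletCharacter ℂ M) t f ℓ` ([SchoofVandervlugt1991, Thm. 2.2], there). -/
def localDensityTriv (M : ℕ) (t : ℤ) (f ℓ : ℕ) : ℚ :=
  dedekindPsi M / dedekindPsi (M / Nat.gcd M f) *
    (((Finset.range M).filter fun x =>
        Nat.Coprime x M ∧ ((M * Nat.gcd M f : ℕ) : ℤ) ∣ (x : ℤ) ^ 2 - t * x + ℓ).card : ℚ)

/-- `classSum M p t ℓ = W_t(ℓ) = Σ_{f ∈ ellipticConductors t ℓ, p ∤ f} h_w((t² - 4ℓ)/f²) · μ_M(t, f, ℓ)` — the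
class-number sum of the elliptic term at trace `t` for the order `O_T` of level `M·(non-split Cartan at p)`, with the
tree's `h_w` (`weightedClassNumber`) and conductors (`ellipticConductors`); the restriction `p ∤ f` is case (I) of the
local factor (RECORD-NSCARTAN §1 (G), `W_t(ℓ)`; the RECORD's `h/w` is `½ h_w`, the `½` is kept outside here). -/
def classSum (M p : ℕ) (t : ℤ) (ℓ : ℕ) : ℚ :=
  ∑ f ∈ (ellipticConductors t ℓ).filter (fun f => ¬ p ∣ f),
    weightedClassNumber ((t ^ 2 - 4 * ℓ) / (f : ℤ) ^ 2) * localDensityTriv M t f ℓ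

/-- The inert traces of the elliptic term at the prime `ℓ`: integers `t` with `t² < 4ℓ` and `((t² - 4ℓ)/p) = -1`. -/
def inertTraces (p ℓ : ℕ) : Finset ℤ :=
  (((List.range (4 * ℓ + 1)).map fun i => (i : ℤ) - 2 * ℓ).toFinset).filter
    fun t => t.natAbs ^ 2 < 4 * ℓ ∧ IsInert p t ℓ

/-- `orderEllipticSum M p d ℓ = ½ Σ_{t inert} c_d(k_t) · W_t(ℓ)` — the geometric side of the type-`θ_d` equation
(RECORD-NSCARTAN §1 (E), summed over the characters of exact order `d`; DERIVED). -/
def orderEllipticSum (M p d ℓ : ℕ) : ℚ :=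
  (1 / 2 : ℚ) * ∑ t ∈ inertTraces p ℓ, (orderWeight p d t ℓ : ℚ) * classSum M p t ℓ

/-- The Dirichlet inverse `β` of the divisor-count function `σ₀` (`Σ_{e ∣ n} σ₀(n/e) β(e) = [n = 1]`; multiplicative,
`β(q) = -2`, `β(q²) = 1`, `β(q^a) = 0` for `a ≥ 3` at a prime `q`: [Belabas–Cohen 2018, Def. 2 / Thm. 4], the weights of
the new-trace formula `Tr^{new}`), by the divisor recursion on a fuel argument (kernel-evaluable). [folklore] -/
def betaAux : ℕ → ℕ → ℤ
  | 0, _ => 0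
  | fuel + 1, n => (if n = 1 then 1 else 0) - ∑ e ∈ n.properDivisors, (Nat.divisors (n / e)).card * betaAux fuel e

/-- `beta n = β(n)`, the Dirichlet inverse of `σ₀` (see `betaAux`). [folklore] -/
def beta (n : ℕ) : ℤ := betaAux n n

/-- `newEllipticSum M p d ℓ = Σ_{M' ∣ M} β(M/M') · orderEllipticSum M' p d ℓ` — the «`M`-new» projection of the
geometric side (RECORD-NSCARTAN §1 (E) «M-new variant»: `Σ_{M' ∣ M} β(M/M') W^{(M')}`, e.g. `W^{(2)} - 2W^{(1)}` for
`M = 2`), which pairs with the spectral sums restricted to the `π` whose conductor has `M`-part EXACTLY `M` (each once);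
this is the form in which the certificates at the census levels (`M = 2, 18, 32, 256`) are solved. DERIVED. -/
def newEllipticSum (M p d ℓ : ℕ) : ℚ :=
  ∑ M' ∈ M.divisors, (beta (M / M') : ℚ) * orderEllipticSum M' p d ℓ

/-! ## 3. Per character, generator-free over `𝔽_{p²} = GaloisField p 2` -/

section PerCharacter

variable (p : ℕ) [Fact p.Prime]

/-- `ν : 𝔽_{p²}^× → ℂ^×` is a character of the torus quotient `T/Z`: it is trivial on `𝔽_p^× ⊂ 𝔽_{p²}^×`. -/
def IsTorusChar (ν : (GaloisField p 2)ˣ →* ℂˣ) : Prop :=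
  ∀ τ : (GaloisField p 2)ˣ, (τ : GaloisField p 2) ∈ Set.range (algebraMap (ZMod p) (GaloisField p 2)) → ν τ = 1

open Classical in
/-- THE NON-SPLIT-CARTAN LOCAL FACTOR, case (I): `c_p(t, ℓ; ν) = ν(τ_t) + ν(τ_t)⁻¹` for a unit root `τ_t` of
`X² - tX + ℓ` in `𝔽_{p²}` (for `t` inert and `ν` a torus character the value does not depend on the chosen root, the
other root being `τ_t^p` with `ν(τ_t^p) = ν(τ_t)⁻¹`); junk value `0` if there is no unit root (never the case: every
quadratic over `𝔽_p` splits in `𝔽_{p²}`, and `ℓ ≠ 0 (mod p)`). The `ν`-weighted count of the TWO `O_T^×`-classes of optimal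
embeddings of the maximal inert order into `O_T` — DERIVED by the cell (RECORD-NSCARTAN §1 (G) (I); NSC-READ-g57 §3 (G));
unweighted count `2` printed in [Chen 1996, Prop. 3.4.1]. -/
noncomputable def charLocalFactor (ν : (GaloisField p 2)ˣ →* ℂˣ) (t : ℤ) (ℓ : ℕ) : ℂ :=
  if h : ∃ τ : (GaloisField p 2)ˣ, (τ : GaloisField p 2) ^ 2 - (t : GaloisField p 2) * τ + (ℓ : GaloisField p 2) = 0
  then ((ν h.choose : ℂˣ) : ℂ) + (((ν h.choose)⁻¹ : ℂˣ) : ℂ) else 0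

/-- `charEllipticSum M p ν ℓ = E_ν(ℓ) = ½ Σ_{t inert} (ν(τ_t) + ν(τ_t)⁻¹) · W_t(ℓ)` — the elliptic term of the trace
of `T_ℓ^ν` on `V[ν]` (RECORD-NSCARTAN §1 (G); DERIVED); in mode A it is the whole geometric side up to sign. -/
noncomputable def charEllipticSum (M : ℕ) (ν : (GaloisField p 2)ˣ →* ℂˣ) (ℓ : ℕ) : ℂ :=
  (1 / 2 : ℂ) * ∑ t ∈ inertTraces p ℓ, charLocalFactor p ν t ℓ * (classSum M p t ℓ : ℂ)

end PerCharacter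

/-! ## 4. «Mode A» and the three named hypothesis-`Prop`s (the cell's DERIVED identities; never axioms, not proved) -/

/-- MODE A of RECORD-NSCARTAN §1: `ℓ` prime, `ℓ ∤ pM`, `4ℓ < p²`, `ℓ ≢ 1 (mod p)` — the range in which the geometric
side has NO `ν`-independent term (no case-(II) conductor since `0 < 4ℓ - t² < p²`, no hyperbolic class since
`ℓ ≢ 1 (mod p)`, no identity/parabolic term for a character of order `≥ 3`). -/
def ModeA (p M ℓ : ℕ) : Prop := ℓ.Prime ∧ ¬ ℓ ∣ p * M ∧ 4 * ℓ < p ^ 2 ∧ ℓ % p ≠ 1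

/-- **HYPOTHESIS-DEF (the cell's DERIVED per-character identity, mode A).** For an abstract trace functional `tr`
(INTENDED: `tr ν ℓ = Tr(T_ℓ^ν | V[ν])`, the trace of the `ν`-normalised Hecke operator at the prime `ℓ` on the weight-2
cusp forms of level `K₀(M)·K_T(p)` with `T`-character `ν`, RECORD-NSCARTAN §1 (S)): for every torus character `ν` with
`ν² ≠ 1` and every mode-A prime `ℓ`, `tr ν ℓ = -E_ν(ℓ)`. The cell's claim (DERIVED: RECORD-NSCARTAN §1 (G), referee
re-derivation NSC-READ-g57 §3; not printed, not proved here) is that the INTENDED `tr` satisfies this for every odd prime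
`p` and every `M ≥ 1` with `p ∤ M`. Meaningful only for the intended `tr`. -/
def TraceIdentityModeA (p M : ℕ) [Fact p.Prime] (tr : ((GaloisField p 2)ˣ →* ℂˣ) → ℕ → ℂ) : Prop :=
  ∀ ν : (GaloisField p 2)ˣ →* ℂˣ, IsTorusChar p ν → ν ^ 2 ≠ 1 →
    ∀ ℓ : ℕ, ModeA p M ℓ → tr ν ℓ = -charEllipticSum p M ν ℓ

/-- **HYPOTHESIS-DEF (the cell's DERIVED type-sum equations, mode A; the equations of the certificates
`LocalTypeNSC_*.engine2.json`, RECORD-NSCARTAN §1 (E)).** For abstract spectral sums `X` and `S` (INTENDED: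
`X ℓ = Σ_π m_M(π)·a_ℓ(π)` over all cuspidal automorphic `π` of `GL₂/ℚ` of conductor `p^a M'`, `a ≤ 2`, `M' ∣ M`, trivial
central character, holomorphic of weight 2, with `m_M(π) = d(M/M')` — i.e. `Σ_{a ≤ 2, M' ∣ M} d(M/M')·Tr(T_ℓ | S₂^{new}(Γ₀(p^a M')))`;
`S d ℓ =` the same sum restricted to the `π` whose local component at `p` is the depth-zero supercuspidal `Ind θ` with
`θ` of exact order `d` on `T/Z`): for every `d ∣ p + 1` with `d ≥ 3` and every mode-A prime `ℓ`,
`S d ℓ = (φ(d)/2)·X ℓ + ½ Σ_{t inert} c_d(k_t)·W_t(ℓ)`. Obtained from `TraceIdentityModeA` and the spectral table (S)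
(`Tr(T_ℓ^ν | V[ν]) = X(ℓ) - S_ν(ℓ)`, [Fulton–Harris §5.2] torus restrictions, CITED) by summing over the `φ(d)` characters of
exact order `d`; DERIVED, not printed, not proved here; meaningful only for the intended `X`, `S`. -/
def TypeSumIdentityModeA (p M : ℕ) (X : ℕ → ℚ) (S : ℕ → ℕ → ℚ) : Prop :=
  ∀ d : ℕ, d ∣ p + 1 → 3 ≤ d → ∀ ℓ : ℕ, ModeA p M ℓ →
    S d ℓ = (Nat.totient d : ℚ) / 2 * X ℓ + orderEllipticSum M p d ℓ

/-- **HYPOTHESIS-DEF («`M`-new» form of `TypeSumIdentityModeA`, the form the certificates use).** For abstract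
spectral sums `Xnew`, `Snew` (INTENDED: `Xnew ℓ = Σ_π a_ℓ(π)` over the cuspidal `π` as in `TypeSumIdentityModeA` whose
conductor is `p^a·M` with `M`-part EXACTLY `M`, `a ≤ 2`, each counted ONCE; `Snew d ℓ` = the same sum over the `π` of
type `θ_d` at `p`): `Snew d ℓ = (φ(d)/2)·Xnew ℓ + newEllipticSum M p d ℓ` for every `d ∣ p + 1`, `d ≥ 3`, and every
mode-A prime `ℓ` (Möbius-type inversion of the `M'`-old multiplicities `d(M/M')` by `β`; RECORD-NSCARTAN §1 (E) «M-new
variant»). DERIVED, not printed, not proved here; meaningful only for the intended `Xnew`, `Snew`. -/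
def NewTypeSumIdentityModeA (p M : ℕ) (Xnew : ℕ → ℚ) (Snew : ℕ → ℕ → ℚ) : Prop :=
  ∀ d : ℕ, d ∣ p + 1 → 3 ≤ d → ∀ ℓ : ℕ, ModeA p M ℓ →
    Snew d ℓ = (Nat.totient d : ℚ) / 2 * Xnew ℓ + newEllipticSum M p d ℓ

/-! ## 5. Kernel sanity checks on the elementary renderings (tiny generic numbers; no census level) -/

/-- `p = 5`, `t = 1`, `ℓ = 2`: `t² - 4ℓ = -7 ≡ 3`, a non-residue mod `5` — inert; `p = 11`, `t = 0`, `ℓ = 3`: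
`-12 ≡ 10`, a non-residue mod `11` — inert; but `-12 ≡ 2 = 3²` mod `7` — not inert at `7`. -/
example : IsInert 5 1 2 ∧ IsInert 11 0 3 ∧ ¬ IsInert 7 0 3 := by unfold IsInert; norm_num [jacobiSym]

/-- Lucas values `U_m(1, 2)` for `m = 0 … 6`: `0, 1, 1, -1, -3, -1, 5`; `5 ∣ U_6` first at `m = 6 = p + 1`, so `τ`
generates `T/Z` for `p = 5`: `torusOrder 5 1 2 = 6`. -/
example : torusOrder 5 1 2 = 6 := by decide

/-- For `p = 11`, `t = 0`, `ℓ = 3` (inert): `τ² = -3 ∈ 𝔽₁₁`, so `τ` has order `2` in `T/Z` (`U₂(0, 3) = 0`). -/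
example : torusOrder 11 0 3 = 2 := by decide

/-- Ramanujan sums (sums of `ζ^k` over the primitive `d`-th roots of unity): `c_8(0) = φ(8) = 4`, `c_8(4) = -4`
(all four `ζ⁴ = -1`), `c_8(2) = 0`, `c_8(1) = μ(8) = 0`; `c_6(0) = 2`, `c_6(1) = μ(6) = 1`, `c_6(2) = -1`, `c_6(3) = -2`. -/
example : ramanujanSum 8 0 = 4 ∧ ramanujanSum 8 4 = -4 ∧ ramanujanSum 8 2 = 0 ∧ ramanujanSum 8 1 = 0 ∧
    ramanujanSum 6 0 = 2 ∧ ramanujanSum 6 1 = 1 ∧ ramanujanSum 6 2 = -1 ∧ ramanujanSum 6 3 = -2 := by decide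

/-- The order weight is generator-free: for `p = 5`, `t = 1`, `ℓ = 2` the class `τ_t` generates `T/Z` (order `6`), so
among the characters of exact order `6` (resp. `3`) the sum of `ν(τ_t)` is `c_6(1) = μ(6) = 1` (resp. `c_3(1) = -1`). -/
example : orderWeight 5 6 1 2 = 1 ∧ orderWeight 5 3 1 2 = -1 := by decide

/-- `β` on prime powers and a composite: `β(1) = 1`, `β(2) = -2`, `β(4) = 1`, `β(8) = 0`, `β(18) = β(2)β(9) = -2`. -/
example : beta 1 = 1 ∧ beta 2 = -2 ∧ beta 4 = 1 ∧ beta 8 = 0 ∧ beta 18 = -2 := by decide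

/-! ## 6. Glue (proved): the `ℚ`-valued local density is the imported one at the trivial character -/

/-- `localDensityTriv M t f ℓ` is the tree's `localDensity M 1 t f ℓ` ([SchoofVandervlugt1991, Thm. 2.2]) for the trivial
Dirichlet character mod `M` (which vanishes off the units). -/
theorem localDensityTriv_cast (M : ℕ) [NeZero M] (t : ℤ) (f ℓ : ℕ) :
    ((localDensityTriv M t f ℓ : ℚ) : ℂ) = localDensity M (1 : DirichletCharacter ℂ M) t f ℓ := by
  have key : ∀ x : ℕ,
      (if ((M * Nat.gcd M f : ℕ) : ℤ) ∣ (x : ℤ) ^ 2 - t * x + ℓ then (1 : DirichletCharacter ℂ M) (x : ZMod M) else 0)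
        = if Nat.Coprime x M ∧ ((M * Nat.gcd M f : ℕ) : ℤ) ∣ (x : ℤ) ^ 2 - t * x + ℓ then (1 : ℂ) else 0 := by
    intro x
    by_cases hc : Nat.Coprime x M
    · have h1 : (1 : DirichletCharacter ℂ M) (x : ZMod M) = 1 :=
        MulChar.one_apply ((ZMod.isUnit_iff_coprime x M).mpr hc)
      by_cases hd : ((M * Nat.gcd M f : ℕ) : ℤ) ∣ (x : ℤ) ^ 2 - t * x + ℓ
      · rw [if_pos hd, if_pos ⟨hc, hd⟩, h1]
      · rw [if_neg hd, if_neg (fun h => hd h.2)]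
    · have h0 : (1 : DirichletCharacter ℂ M) (x : ZMod M) = 0 :=
        MulChar.map_nonunit _ (mt (ZMod.isUnit_iff_coprime x M).mp hc)
      by_cases hd : ((M * Nat.gcd M f : ℕ) : ℤ) ∣ (x : ℤ) ^ 2 - t * x + ℓ
      · rw [if_pos hd, if_neg (fun h => hc h.1), h0]
      · rw [if_neg hd, if_neg (fun h => hc h.1)]
  unfold localDensityTriv localDensity
  simp_rw [key, Finset.card_filter]
  push_cast
  congr 1
  exact Finset.sum_congr rfl fun x _ => by split_ifs <;> simp

/-! ## 7. Glue (proved): the divisor recursions compute what they claim — `Σ_{e ∣ d} c_e(k) = d·[d ∣ k]` and `Σ_{e ∣ n} σ₀(n/e)·β(e) = [n = 1]` -/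


/-- The fuel argument of `ramanujanSumAux` is irrelevant once it is at least the index. -/
theorem ramanujanSumAux_stable (k : ℕ) : ∀ fuel e : ℕ, e ≤ fuel → ramanujanSumAux k fuel e = ramanujanSumAux k e e := by
  intro fuel
  induction fuel using Nat.strong_induction_on with
  | _ fuel ih =>
    intro e he
    cases fuel with
    | zero => simp at he; subst he; rfl
    | succ m =>
      cases e with
      | zero => simp [ramanujanSumAux]
      | succ e' =>
        simp only [ramanujanSumAux]
        congr 1
        refine Finset.sum_congr rfl fun x hx => ?_
        have hxlt : x < e' + 1 := (Nat.mem_properDivisors.mp hx).2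
        rw [ih m (Nat.lt_succ_self m) x (by omega), ih e' (by omega) x (by omega)]

/-- The defining property of Ramanujan sums: `Σ_{e ∣ d} c_e(k) = d·[d ∣ k]` (the sum of `ζ^k` over all `d`-th roots of unity). -/
theorem sum_divisors_ramanujanSum (d k : ℕ) (hd : d ≠ 0) :
    ∑ e ∈ d.divisors, ramanujanSum e k = if d ∣ k then (d : ℤ) else 0 := by
  rw [← Nat.cons_self_properDivisors hd, Finset.sum_cons]
  have h1 : ramanujanSum d k = (if d ∣ k then (d : ℤ) else 0) - ∑ e ∈ d.properDivisors, ramanujanSum e k := by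
    cases d with
    | zero => exact absurd rfl hd
    | succ m =>
      simp only [ramanujanSum, ramanujanSumAux]
      congr 1
      refine Finset.sum_congr rfl fun x hx => ?_
      have hxlt : x < m + 1 := (Nat.mem_properDivisors.mp hx).2
      exact ramanujanSumAux_stable k m x (by omega)
  rw [h1]; ring

/-- The fuel argument of `betaAux` is irrelevant once it is at least the index. -/
theorem betaAux_stable : ∀ fuel n : ℕ, n ≤ fuel → betaAux fuel n = betaAux n n := by
  intro fuel
  induction fuel using Nat.strong_induction_on with
  | _ fuel ih =>
    intro n hn
    cases fuel with
    | zero => simp at hn; subst hn; rfl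
    | succ m =>
      cases n with
      | zero => simp [betaAux]
      | succ n' =>
        simp only [betaAux]
        congr 1
        refine Finset.sum_congr rfl fun x hx => ?_
        have hxlt : x < n' + 1 := (Nat.mem_properDivisors.mp hx).2
        rw [ih m (Nat.lt_succ_self m) x (by omega), ih n' (by omega) x (by omega)]

/-- The defining property of `beta`: it is the Dirichlet inverse of the divisor-count function,
`Σ_{e ∣ n} σ₀(n/e)·β(e) = [n = 1]`. -/
theorem sum_divisors_beta (n : ℕ) (hn : n ≠ 0) :
    ∑ e ∈ n.divisors, ((Nat.divisors (n / e)).card : ℤ) * beta e = if n = 1 then 1 else 0 := by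
  rw [← Nat.cons_self_properDivisors hn, Finset.sum_cons]
  have h1 : beta n = (if n = 1 then (1 : ℤ) else 0) - ∑ e ∈ n.properDivisors, ((Nat.divisors (n / e)).card : ℤ) * beta e := by
    cases n with
    | zero => exact absurd rfl hn
    | succ m =>
      simp only [beta, betaAux]
      congr 1
      refine Finset.sum_congr rfl fun x hx => ?_
      have hxlt : x < m + 1 := (Nat.mem_properDivisors.mp hx).2
      rw [betaAux_stable m x (by omega)]
  rw [h1, Nat.div_self (Nat.pos_of_ne_zero hn), Nat.divisors_one, Finset.card_singleton]
  push_cast; ring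

end Summit.Ventures.AbcSig.NSCartan
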